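import Summits.Ventures.Crystal3D.Theorems.StickyWulffConstantGenericWallFloorTubeWalk
import Summits.Ventures.Crystal3D.Theorems.StickyWulffConstantGenericWallFloorSealing
import HarnessLib

/-!
# Sliver-free sealing: deep balls are sample balls WITHOUT the clean-sliver hypothesis

HONEST FRAMING. Venture `Summits/Ventures/Crystal3D` (cell `crystal3d-full`), helper for the crux
`GenericWallFloor` (stmt-Ventures-19480) of `route-Ventures-StickyWulffConstant`, REGISTERED line `WallLedgerG`,
open stub `stub_twoSlabAdhesion`.  Rung credit only; F-C1 not moved.

All rungs landed so far (rigid p559312/p574709, general modulo twin caps p572014, tubes p585961/p586858/p587147)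
carry the CLEAN-SLIVER hypotheses `∀ p ∈ X, p₂ < −2R₀ + 1 → p ∈ Λ₁` (and the top mirror), which the stub does not
have.  Every consumer uses them only OFF THE RIM, and off the rim they are THEOREMS of the cell: by the covering
lemma `movedFcc_exists_near_above/below` (crystal3d-wulff-p2, `…Sealing`) a non-lattice ball `q` at height
`≤ −R₀ − 1` with lateral radius `≤ ρ − 1` has a lattice point `v` with `dist q v < 1` inside the clamped window,
hence a ball of `P₁ ⊆ X` — contradicting `1`-separation.  So:
* `mem_sample_bottom_of_deep'`, `mem_sample_top_of_deep'` — the sealing lemmas of `…ExitLocation` with the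
  clean-sliver hypothesis REMOVED (and `R₀ ≥ 2` only).
Re-threading the consumers (TopTerminal → TubeWalk → … → GeneralRungTubes, and the face ledger) through these
primed lemmas removes the hypothesis from the rungs; recorded as the next mechanical step.
WHAT THIS IS NOT: not the stub; F-C1 not moved.
-/

noncomputable section

namespace Summit.Ventures.Crystal3D.Theorems

open Summit.Ventures.Crystal3D Finset
open Literature.MathematicalPhysics.StatisticalMechanics (fccStacking)
open scoped InnerProductSpace

/-- **Sliver-free sealing below.**  A ball of `X` at height `≤ −R₀ − 1` and lateral radius `≤ ρ − 1` is a ball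
of the bottom sample — no cleanliness hypothesis. -/
theorem mem_sample_bottom_of_deep'
    (A : EuclideanSpace ℝ (Fin 3) ≃ₗᵢ[ℝ] EuclideanSpace ℝ (Fin 3)) (t : EuclideanSpace ℝ (Fin 3))
    (X P : Finset (EuclideanSpace ℝ (Fin 3))) (R₀ ρ : ℝ) (hρ : 1 ≤ ρ)
    (hX : ∀ p ∈ X, ∀ q ∈ X, p ≠ q → 1 ≤ dist p q) (hPX : P ⊆ X)
    (hcell : ∀ p ∈ X, -(2 * R₀) ≤ p 2)
    (hP : ∀ p, p ∈ P ↔ (p ∈ (fun q => A q + t) '' fccStacking 1 (Real.sqrt (2 / 3)) ∧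
      -(2 * R₀) ≤ p 2 ∧ p 2 ≤ -R₀ ∧ p 0 ^ 2 + p 1 ^ 2 ≤ ρ ^ 2))
    {q : EuclideanSpace ℝ (Fin 3)} (hq : q ∈ X) (hq2 : q 2 ≤ -R₀ - 1) (hqr : q 0 ^ 2 + q 1 ^ 2 ≤ (ρ - 1) ^ 2) :
    q ∈ P := by
  have hq1 : -(2 * R₀) ≤ q 2 := hcell q hq
  by_cases hqΛ : q ∈ (fun p => A p + t) '' fccStacking 1 (Real.sqrt (2 / 3))
  · rw [hP]
    exact ⟨hqΛ, hq1, by linarith, hqr.trans (by nlinarith)⟩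
  · exfalso
    obtain ⟨v, hvΛ, hd, hle⟩ := movedFcc_exists_near_above A t q hqΛ
    have hc : ∀ i : Fin 3, |v i - q i| ≤ dist q v := fun i => by
      rw [dist_comm]; exact abs_apply_sub_le_dist v q i
    have hv2 : v 2 < q 2 + 1 := by have := (abs_le.1 (hc 2)).2; linarith
    have hvh : (v 0 - q 0) ^ 2 + (v 1 - q 1) ^ 2 ≤ 1 ^ 2 := by
      have hn := norm_sq_eq_fin3 (v - q)
      have hd1 : ‖v - q‖ ^ 2 ≤ 1 := by
        rw [← dist_eq_norm, dist_comm]; nlinarith [dist_nonneg (x := q) (y := v)]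
      simp only [PiLp.sub_apply] at hn
      nlinarith [sq_nonneg ((v - q) 2)]
    have hvr : v 0 ^ 2 + v 1 ^ 2 ≤ ρ ^ 2 := by
      have := sq2_add_le (by linarith : (0 : ℝ) ≤ ρ - 1) (by norm_num : (0 : ℝ) ≤ 1) hqr hvh
      have e0 : v 0 = q 0 + (v 0 - q 0) := by ring
      have e1 : v 1 = q 1 + (v 1 - q 1) := by ring
      rw [e0, e1]; nlinarith
    have hvP : v ∈ P := by
      rw [hP]; exact ⟨hvΛ, by linarith, by linarith, hvr⟩
    have hne : q ≠ v := fun h => hqΛ (h ▸ hvΛ)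
    have := hX q hq v (hPX hvP) hne
    linarith

/-- **Sliver-free sealing above.**  A ball of `X` at height `≥ h + R₀ + 1` and lateral radius `≤ ρ − 1` is a
ball of the top sample — no cleanliness hypothesis. -/
theorem mem_sample_top_of_deep'
    (A : EuclideanSpace ℝ (Fin 3) ≃ₗᵢ[ℝ] EuclideanSpace ℝ (Fin 3)) (t : EuclideanSpace ℝ (Fin 3))
    (X P : Finset (EuclideanSpace ℝ (Fin 3))) (R₀ h ρ : ℝ) (hρ : 1 ≤ ρ)
    (hX : ∀ p ∈ X, ∀ q ∈ X, p ≠ q → 1 ≤ dist p q) (hPX : P ⊆ X)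
    (hcell : ∀ p ∈ X, p 2 ≤ h + 2 * R₀)
    (hP : ∀ p, p ∈ P ↔ (p ∈ (fun q => A q + t) '' fccStacking 1 (Real.sqrt (2 / 3)) ∧
      h + R₀ ≤ p 2 ∧ p 2 ≤ h + 2 * R₀ ∧ p 0 ^ 2 + p 1 ^ 2 ≤ ρ ^ 2))
    {q : EuclideanSpace ℝ (Fin 3)} (hq : q ∈ X) (hq2 : h + R₀ + 1 ≤ q 2) (hqr : q 0 ^ 2 + q 1 ^ 2 ≤ (ρ - 1) ^ 2) :
    q ∈ P := by
  have hq1 : q 2 ≤ h + 2 * R₀ := hcell q hq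
  by_cases hqΛ : q ∈ (fun p => A p + t) '' fccStacking 1 (Real.sqrt (2 / 3))
  · rw [hP]
    exact ⟨hqΛ, by linarith, hq1, hqr.trans (by nlinarith)⟩
  · exfalso
    obtain ⟨v, hvΛ, hd, hle⟩ := movedFcc_exists_near_below A t q hqΛ
    have hc : ∀ i : Fin 3, |v i - q i| ≤ dist q v := fun i => by
      rw [dist_comm]; exact abs_apply_sub_le_dist v q i
    have hv2 : q 2 - 1 < v 2 := by have := (abs_le.1 (hc 2)).1; linarith
    have hvh : (v 0 - q 0) ^ 2 + (v 1 - q 1) ^ 2 ≤ 1 ^ 2 := by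
      have hn := norm_sq_eq_fin3 (v - q)
      have hd1 : ‖v - q‖ ^ 2 ≤ 1 := by
        rw [← dist_eq_norm, dist_comm]; nlinarith [dist_nonneg (x := q) (y := v)]
      simp only [PiLp.sub_apply] at hn
      nlinarith [sq_nonneg ((v - q) 2)]
    have hvr : v 0 ^ 2 + v 1 ^ 2 ≤ ρ ^ 2 := by
      have := sq2_add_le (by linarith : (0 : ℝ) ≤ ρ - 1) (by norm_num : (0 : ℝ) ≤ 1) hqr hvh
      have e0 : v 0 = q 0 + (v 0 - q 0) := by ring
      have e1 : v 1 = q 1 + (v 1 - q 1) := by ring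
      rw [e0, e1]; nlinarith
    have hvP : v ∈ P := by
      rw [hP]; exact ⟨hvΛ, by linarith, by linarith, hvr⟩
    have hne : q ≠ v := fun h' => hqΛ (h' ▸ hvΛ)
    have := hX q hq v (hPX hvP) hne
    linarith

end Summit.Ventures.Crystal3D.Theorems

end
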